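import Summits.HodgeConjecture.HodgeConjecture.Theorems.BiquadraticSecantLiftDefs
import Literature.AlgebraicGeometry.HodgeTheory.WeilClassesCMReductionPolarized
import Literature.AlgebraicGeometry.HodgeTheory.WeilClassesFieldIsogenyInvariance
import Literature.AlgebraicGeometry.HodgeTheory.GlobalInvariantCycles
import Literature.AlgebraicGeometry.Motives.FamiliesVHS
import HarnessLib
import Literature.AlgebraicGeometry.HodgeTheory.WeilFamilyReachCMField

/-!
# BiquadraticSecantLift · X1 — the REACH stub of line `seed` of crux `MarkmanBiquadraticTwelvefolds`
# (stmt-HodgeConjecture-22132), CLOSED MODULO one named literature fact and the positivity of the target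

Helper file (`--supports stmt-HodgeConjecture-22132`) for the registered skeleton
`Cruxes/MarkmanBiquadraticTwelvefolds/Lines/seed.lean` (stub `stub_seedReach : SeedReach`). Nothing here proves the
Hodge conjecture, rung H2 `WeilSixfolds`, X1, or the stub itself: the stub asserts the EXISTENCE of a smooth
projective family of abelian twelvefolds (Deligne's family over a level cover of the Hermitian symmetric domain of a
split `L`-Hermitian space, `L = ℚ[T]/(R_(d,m)(T²)) = ℚ(√-d, √m)`), and the tree constructs no moduli space of abelian
varieties, no universal abelian scheme and no period map — every reach statement of the tree is a NAMED FACT taken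
as a hypothesis (`HodgeTheory.weilFamilyReach_hyperbolic` for an imaginary QUADRATIC field, Weil classes in the
degree of the dimension; `Andre1996.andre1996_weilLineFamily_throughSplitAnchor` for any CM field, whose reaching
homomorphism is recorded neither as an isogeny nor as `E`-linear). This file therefore

* states INLINE, for relocation to `Literature/AlgebraicGeometry/HodgeTheory/WeilFamilyReachCMField`, the CM-field
  sibling `deligne1982_weilFamilyReachCM_polarizedSplit` of `weilFamilyReach_hyperbolic` in EXACTLY the typing of the
  CM ladder (`Deligne1982.IsWeilTypeCM`, a polarization class with a Kähler real multiple, Rosati = complex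
  conjugation, split Deligne discriminant `HodgeTheory.splitDiscriminantClassCM`, an `η^*`-stable rational Lagrangian,
  `HodgeTheory.weilClassesField`): Deligne's polarized family THROUGH a polarized split anchor `(P, η_P, h)` (the anchor
  is a fibre on the nose), carrying the relative polarization class `H` and a global class `W` extending a given
  non-zero rational `E`-Weil class `w` of `P` (monodromy `Γ ⊂ SU`, theorem of the fixed part), and reaching every
  GENUINELY POLARIZED split target `(B, η)` of the same type (`HodgeTheory.IsPolarizedHyperbolicWeilTypeCM`) up to an
  `E`-LINEAR ISOGENY `g : B ⟶ B' ≅ 𝒳_{s₁}` with `e₁^*(W|_{s₁})` a non-zero element of `W_E(B', η') ⊗ ℂ`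
  — [Deligne1982HodgeCycles, proof of Thm. 4.8]: the quadruples `(A₁, θ₁, ν₁, k₁)`, «Note that `A` is a member of
  the family», the algebraic family `Γ\B → Γ\X⁺` for `n ≥ 3`; Cor. 4.2 (Landherr) for the membership of the target;
* proves from it `seedReachAt_polarized_of_weilFamilyReachCM`: the statement `SeedReachAt d m` of the skeleton WITH
  THE TARGET POLARIZED (`IsPolarizedHyperbolicWeilTypeCM B η R_(d,m) 2 3` in place of `IsHyperbolicWeilTypeCM`), by
  specialisation `(R, e₀, k) = (R_(d,m), 2, 3)`;
* proves `seedReachAt_of_weilFamilyReachCM_of_polarizedTargets` / `seedReach_of_weilFamilyReachCM_of_polarizedTargets`: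
  the skeleton's `SeedReachAt d m` / `SeedReach` VERBATIM (with the route's `bqPoly` of `BiquadraticSecantLiftDefs`,
  definitionally the skeleton's), from the named fact AND the inline hypothesis that every CLASS-LEVEL hyperbolic
  target of the cell is polarized hyperbolic (`IsHyperbolicWeilTypeCM → IsPolarizedHyperbolicWeilTypeCM` at
  `(R_(d,m), 2, 3)`).

WHY THE SECOND HYPOTHESIS (the finding of this seat, for the planner): the crux X1 and the stub quantify over
CLASS-LEVEL targets — `IsHyperbolicWeilTypeCM` carries a polarization CLASS (`IsPolarizationClass`: rational,
divisorial, hard Lefschetz — NO positivity) — whereas a point of Deligne's `X⁺` is a complex structure `J` with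
`ψ(x, Jy)` POSITIVE definite (LNM 900, re-ed. p. 35 (b′)); Milne 2020 §2.1: «If `λ` [a polarization] can be chosen so
that `φ` is split … then `(A, ν)` is said to be of split Weil type». A fibre of the family is genuinely polarized, and
so is anything isogenous to it; hence `SeedReachAt` for a target `B` is EQUIVALENT, given the fact, to `B` carrying a
genuine split `L`-polarization. That positivity supply (a Rosati-compatible Kähler class exists by the tree's
`Deligne1982.exists_rosatiCompatible_kaehlerClass`; matching its discriminant class with the split one is a
norm-residue computation in `F^×/N_{L/F}(L^×)` — Hasse norm theorem, weak approximation, Landherr) is not in the tree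
and not a sentence of the cited sources; it is kept as an explicit hypothesis, never asserted.

## References
* [Deligne1982HodgeCycles] P. Deligne (notes by J. S. Milne), Hodge cycles on abelian varieties, LNM 900 (1982), §4:
  Cor. 4.2, Prop. 4.4, Lemma 4.6, Thm. 4.8 and its proof (re-edition pp. 34–37: quadruples `(A₁, θ₁, ν₁, k₁)`, `X⁺`,
  «`A` is a member of the family», `Γ`, `n ≥ 3`, `Γ\B → Γ\X⁺`), Remark 4.9.
* [Andre1996Motifs] Y. André, Publ. Math. IHÉS 83 (1996), §6.3 a)–c), proof of Lemme 6.3.3 (p. 33).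
* [Landherr1936HermitianForms] W. Landherr, Abh. Math. Sem. Hamburg 11 (1936) 245–248.
* [Milne2020HodgeClassesAV] J. S. Milne, Hodge classes on abelian varieties, arXiv:2010.08857, §2 2.1.
* [vanGeemen1994HodgeAV] B. van Geemen, LNM 1594 (1994), Lemma 5.2, 5.3–5.11 (the quadratic case).
* [MumfordFogartyKirwan1994] GIT, 3rd ed., Thm. 7.9–7.10. [DeligneHodgeII1971] Thm. 4.1.1. [Milne1986AbelianVarieties] §8.
-/

-- every declaration of this problem lives in `Summit.HodgeConjecture.HodgeConjecture.…` (summit = sub-problem)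
set_option linter.dupNamespace false

noncomputable section

open CategoryTheory
open Literature.AlgebraicGeometry Literature.AlgebraicGeometry.Motives Literature.AlgebraicGeometry.HodgeTheory
open Literature.AlgebraicGeometry.Deligne1982
open Literature.AlgebraicTopology.SingularHomology
open Literature.AlgebraicGeometry.VanGeemen1994 (pullbackOne)

namespace Summit.HodgeConjecture.HodgeConjecture.BiquadraticSecantLift

/-! ## §1 The named fact (CM-field sibling of `HodgeTheory.weilFamilyReach_hyperbolic`; to be relocated) -/

/-- **REACH at `(d, m)` for POLARIZED targets** — the statement `SeedReachAt d m` of the skeleton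
`Cruxes/MarkmanBiquadraticTwelvefolds/Lines/seed.lean` with the target hypothesis `IsHyperbolicWeilTypeCM` replaced by
`IsPolarizedHyperbolicWeilTypeCM` (Deligne's Thm. 4.8 (a)+(b) for a genuine polarization), proved from the named fact
by specialisation to `(R, e₀, k) = (R_(d,m), 2, 3)` (`2·3·2 = 12`, `3·2 = 6`). CONDITIONAL on the named fact only.
[cite: Deligne1982HodgeCycles, §4 proof of Thm. 4.8] [cite: Landherr1936HermitianForms] -/
theorem seedReachAt_polarized_of_weilFamilyReachCM (hF : Literature.AlgebraicGeometry.HodgeTheory.deligne1982_weilFamilyReachCM_polarizedSplit) (d m : ℕ) :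
    ∀ (P : AbelianVariety ℂ) (ηP : P ⟶ P) (h : complexBetti P.X 2) (w : complexBetti P.X (2 * 3))
      [Fact (Irreducible (realPolyQ (bqPoly d m)))],
      IsWeilTypeCM P ηP (bqPoly d m) 2 3 → IsPolarizationClass P.dim P.X h →
      (∃ s : ℝ, s ≠ 0 ∧ IsKaehlerClass P.dim P.X ((s : ℂ) • h)) →
      (∀ x y : complexBetti P.X 1,
        polarizationPairingOne P.X h (P.dim - 1) (pullbackOne P ηP x) y =
          -polarizationPairingOne P.X h (P.dim - 1) x (pullbackOne P ηP y)) →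
      HasWeilDiscriminantCM P ηP (bqPoly d m) 2 3 h (splitDiscriminantClassCM (bqPoly d m) 3) →
      IsHyperbolicWeilType P ηP (3 * 2) h →
      w ∈ weilClassesField P ηP ((bqPoly d m).comp (Polynomial.X ^ 2)) (2 * 3) → IsRationalClass w → w ≠ 0 →
      ∀ (B : AbelianVariety ℂ) (η : B ⟶ B), IsPolarizedHyperbolicWeilTypeCM B η (bqPoly d m) 2 3 →
        ∃ (𝒳 S : SchemeOver ℂ) (f : 𝒳 ⟶ S) (s₀ s₁ : ComplexPoints S) (e' : P.X ≅ fiberOver f s₀)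
          (B' : AbelianVariety ℂ) (η' : B' ⟶ B') (g : B ⟶ B') (e₁ : B'.X ≅ fiberOver f s₁)
          (H : complexBetti 𝒳 2) (W : complexBetti 𝒳 (2 * 3)),
          IsSmoothProjectiveFamily f (2 * 3 * 2) ∧ IsQuasiProjectiveOver 𝒳 ∧ IsQuasiProjectiveOver S ∧
          IrreducibleSpace S.left ∧ AlgebraicGeometry.Smooth S.hom ∧
          (∀ s : ComplexPoints S, IsRationalClass (complexBetti.map (fiberι f s) 2 H) ∧
              IsOfHodgeType (2 * 3 * 2) (fiberOver f s) 2 1 1 (complexBetti.map (fiberι f s) 2 H)) ∧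
          (∀ s : ComplexPoints S, IsRationalClass (complexBetti.map (fiberι f s) (2 * 3) W) ∧
              IsOfHodgeType (2 * 3 * 2) (fiberOver f s) (2 * 3) 3 3 (complexBetti.map (fiberι f s) (2 * 3) W)) ∧
          complexBetti.map e'.hom 2 (complexBetti.map (fiberι f s₀) 2 H) = h ∧
          complexBetti.map e'.hom (2 * 3) (complexBetti.map (fiberι f s₀) (2 * 3) W) = w ∧
          AbelianVariety.IsIsogeny g ∧ g ≫ η' = η ≫ g ∧ B'.dim = 2 * 3 * 2 ∧
          complexBetti.map e₁.hom (2 * 3) (complexBetti.map (fiberι f s₁) (2 * 3) W) ∈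
            weilClassesField B' η' ((bqPoly d m).comp (Polynomial.X ^ 2)) (2 * 3) ∧
          complexBetti.map e₁.hom (2 * 3) (complexBetti.map (fiberι f s₁) (2 * 3) W) ≠ 0 := by
  intro P ηP h w _ hWP hpol hkae hros hdisc hlag hwW hwQ hw0 B η hB
  exact hF (bqPoly d m) 2 3 P ηP h w hWP hpol hkae hros hdisc hlag hwW hwQ hw0 B η hB

/-! ## §3 The stub's statement VERBATIM (class-level targets), from the fact and the positivity of the targets -/

/-- **REACH at `(d, m)` as registered** — the statement `SeedReachAt d m` of the skeleton VERBATIM (its `bqPoly` is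
definitionally the route's), from the named fact AND the hypothesis that every CLASS-LEVEL hyperbolic target of the
cell `(R_(d,m), 2, 3)` carries a GENUINE split `L`-polarization (`IsHyperbolicWeilTypeCM → IsPolarizedHyperbolicWeilTypeCM`:
the positivity supply — a fibre of Deligne's family is genuinely polarized, so this hypothesis is also NECESSARY given
the fact; it is not in the tree and is NOT asserted here). [cite: Deligne1982HodgeCycles, §4 proof of Thm. 4.8 (X⁺: ψ(x, Jy) > 0)]
[cite: Milne2020HodgeClassesAV, §2 2.1] -/
theorem seedReachAt_of_weilFamilyReachCM_of_polarizedTargets (hF : Literature.AlgebraicGeometry.HodgeTheory.deligne1982_weilFamilyReachCM_polarizedSplit)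
    (d m : ℕ)
    (hpos : ∀ (B : AbelianVariety ℂ) (η : B ⟶ B),
      IsHyperbolicWeilTypeCM B η (bqPoly d m) 2 3 → IsPolarizedHyperbolicWeilTypeCM B η (bqPoly d m) 2 3) :
    ∀ (P : AbelianVariety ℂ) (ηP : P ⟶ P) (h : complexBetti P.X 2) (w : complexBetti P.X (2 * 3))
      [Fact (Irreducible (realPolyQ (bqPoly d m)))],
      IsWeilTypeCM P ηP (bqPoly d m) 2 3 → IsPolarizationClass P.dim P.X h →
      (∃ s : ℝ, s ≠ 0 ∧ IsKaehlerClass P.dim P.X ((s : ℂ) • h)) →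
      (∀ x y : complexBetti P.X 1,
        polarizationPairingOne P.X h (P.dim - 1) (pullbackOne P ηP x) y =
          -polarizationPairingOne P.X h (P.dim - 1) x (pullbackOne P ηP y)) →
      HasWeilDiscriminantCM P ηP (bqPoly d m) 2 3 h (splitDiscriminantClassCM (bqPoly d m) 3) →
      IsHyperbolicWeilType P ηP (3 * 2) h →
      w ∈ weilClassesField P ηP ((bqPoly d m).comp (Polynomial.X ^ 2)) (2 * 3) → IsRationalClass w → w ≠ 0 →
      ∀ (B : AbelianVariety ℂ) (η : B ⟶ B), IsHyperbolicWeilTypeCM B η (bqPoly d m) 2 3 →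
        ∃ (𝒳 S : SchemeOver ℂ) (f : 𝒳 ⟶ S) (s₀ s₁ : ComplexPoints S) (e' : P.X ≅ fiberOver f s₀)
          (B' : AbelianVariety ℂ) (η' : B' ⟶ B') (g : B ⟶ B') (e₁ : B'.X ≅ fiberOver f s₁)
          (H : complexBetti 𝒳 2) (W : complexBetti 𝒳 (2 * 3)),
          IsSmoothProjectiveFamily f (2 * 3 * 2) ∧ IsQuasiProjectiveOver 𝒳 ∧ IsQuasiProjectiveOver S ∧
          IrreducibleSpace S.left ∧ AlgebraicGeometry.Smooth S.hom ∧
          (∀ s : ComplexPoints S, IsRationalClass (complexBetti.map (fiberι f s) 2 H) ∧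
              IsOfHodgeType (2 * 3 * 2) (fiberOver f s) 2 1 1 (complexBetti.map (fiberι f s) 2 H)) ∧
          (∀ s : ComplexPoints S, IsRationalClass (complexBetti.map (fiberι f s) (2 * 3) W) ∧
              IsOfHodgeType (2 * 3 * 2) (fiberOver f s) (2 * 3) 3 3 (complexBetti.map (fiberι f s) (2 * 3) W)) ∧
          complexBetti.map e'.hom 2 (complexBetti.map (fiberι f s₀) 2 H) = h ∧
          complexBetti.map e'.hom (2 * 3) (complexBetti.map (fiberι f s₀) (2 * 3) W) = w ∧
          AbelianVariety.IsIsogeny g ∧ g ≫ η' = η ≫ g ∧ B'.dim = 2 * 3 * 2 ∧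
          complexBetti.map e₁.hom (2 * 3) (complexBetti.map (fiberι f s₁) (2 * 3) W) ∈
            weilClassesField B' η' ((bqPoly d m).comp (Polynomial.X ^ 2)) (2 * 3) ∧
          complexBetti.map e₁.hom (2 * 3) (complexBetti.map (fiberι f s₁) (2 * 3) W) ≠ 0 := by
  intro P ηP h w _ hWP hpol hkae hros hdisc hlag hwW hwQ hw0 B η hB
  exact hF (bqPoly d m) 2 3 P ηP h w hWP hpol hkae hros hdisc hlag hwW hwQ hw0 B η (hpos B η hB)

/-- **REACH for all `(d, m)` as registered** — the statement `SeedReach` of the skeleton VERBATIM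
(`∀ d m, 0 < d → 0 < m → ¬ IsSquare m → SeedReachAt d m`), from the named fact and the positivity supply on every
cell of the route. With both hypotheses in context the skeleton's `stub_seedReach` closes by `exact`; neither
hypothesis is discharged here (the first is a theorem in print that the tree cannot construct, the second is the
class-level-versus-polarized gap of the crux's typing). [cite: Deligne1982HodgeCycles, §4 proof of Thm. 4.8]
[cite: Milne2020HodgeClassesAV, §2 2.1] -/
theorem seedReach_of_weilFamilyReachCM_of_polarizedTargets (hF : Literature.AlgebraicGeometry.HodgeTheory.deligne1982_weilFamilyReachCM_polarizedSplit)
    (hpos : ∀ (d m : ℕ) (B : AbelianVariety ℂ) (η : B ⟶ B), 0 < d → 0 < m → ¬ IsSquare m →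
      IsHyperbolicWeilTypeCM B η (bqPoly d m) 2 3 → IsPolarizedHyperbolicWeilTypeCM B η (bqPoly d m) 2 3) :
    ∀ d m : ℕ, 0 < d → 0 < m → ¬ IsSquare m →
    ∀ (P : AbelianVariety ℂ) (ηP : P ⟶ P) (h : complexBetti P.X 2) (w : complexBetti P.X (2 * 3))
      [Fact (Irreducible (realPolyQ (bqPoly d m)))],
      IsWeilTypeCM P ηP (bqPoly d m) 2 3 → IsPolarizationClass P.dim P.X h →
      (∃ s : ℝ, s ≠ 0 ∧ IsKaehlerClass P.dim P.X ((s : ℂ) • h)) →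
      (∀ x y : complexBetti P.X 1,
        polarizationPairingOne P.X h (P.dim - 1) (pullbackOne P ηP x) y =
          -polarizationPairingOne P.X h (P.dim - 1) x (pullbackOne P ηP y)) →
      HasWeilDiscriminantCM P ηP (bqPoly d m) 2 3 h (splitDiscriminantClassCM (bqPoly d m) 3) →
      IsHyperbolicWeilType P ηP (3 * 2) h →
      w ∈ weilClassesField P ηP ((bqPoly d m).comp (Polynomial.X ^ 2)) (2 * 3) → IsRationalClass w → w ≠ 0 →
      ∀ (B : AbelianVariety ℂ) (η : B ⟶ B), IsHyperbolicWeilTypeCM B η (bqPoly d m) 2 3 →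
        ∃ (𝒳 S : SchemeOver ℂ) (f : 𝒳 ⟶ S) (s₀ s₁ : ComplexPoints S) (e' : P.X ≅ fiberOver f s₀)
          (B' : AbelianVariety ℂ) (η' : B' ⟶ B') (g : B ⟶ B') (e₁ : B'.X ≅ fiberOver f s₁)
          (H : complexBetti 𝒳 2) (W : complexBetti 𝒳 (2 * 3)),
          IsSmoothProjectiveFamily f (2 * 3 * 2) ∧ IsQuasiProjectiveOver 𝒳 ∧ IsQuasiProjectiveOver S ∧
          IrreducibleSpace S.left ∧ AlgebraicGeometry.Smooth S.hom ∧
          (∀ s : ComplexPoints S, IsRationalClass (complexBetti.map (fiberι f s) 2 H) ∧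
              IsOfHodgeType (2 * 3 * 2) (fiberOver f s) 2 1 1 (complexBetti.map (fiberι f s) 2 H)) ∧
          (∀ s : ComplexPoints S, IsRationalClass (complexBetti.map (fiberι f s) (2 * 3) W) ∧
              IsOfHodgeType (2 * 3 * 2) (fiberOver f s) (2 * 3) 3 3 (complexBetti.map (fiberι f s) (2 * 3) W)) ∧
          complexBetti.map e'.hom 2 (complexBetti.map (fiberι f s₀) 2 H) = h ∧
          complexBetti.map e'.hom (2 * 3) (complexBetti.map (fiberι f s₀) (2 * 3) W) = w ∧
          AbelianVariety.IsIsogeny g ∧ g ≫ η' = η ≫ g ∧ B'.dim = 2 * 3 * 2 ∧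
          complexBetti.map e₁.hom (2 * 3) (complexBetti.map (fiberι f s₁) (2 * 3) W) ∈
            weilClassesField B' η' ((bqPoly d m).comp (Polynomial.X ^ 2)) (2 * 3) ∧
          complexBetti.map e₁.hom (2 * 3) (complexBetti.map (fiberι f s₁) (2 * 3) W) ≠ 0 :=
  fun d m hd hm hsq =>
    seedReachAt_of_weilFamilyReachCM_of_polarizedTargets hF d m (fun B η hB => hpos d m B η hd hm hsq hB)

end Summit.HodgeConjecture.HodgeConjecture.BiquadraticSecantLift

end
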